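import Summits.KontsevichZagierPeriods.KontsevichZagierPeriods.Theorems.LogPrimitiveNL.Negative.Rigidity
import Summits.KontsevichZagierPeriods.KontsevichZagierPeriods.Theorems.LiouvilleUnfoldingLogPrimitiveNLGlue
import Summits.KontsevichZagierPeriods.KontsevichZagierPeriods.Theorems.LiouvilleUnfoldingLogPrimitiveNLStubMinNormalisation
import Literature.NumberTheory.Transcendental.KZLogCalculusProofs
import Literature.NumberTheory.Transcendental.SemialgebraicDerivativeProofs
import Literature.RingTheory.PowerSeries.LaurentSeriesConstants

/-!
# Line `ax-schanuel-germs` for crux `LogPrimitiveNL` (stmt-KontsevichZagierPeriods-2836) — skeleton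
(second lead, unit `line-stmt-KontsevichZagierPeriods-2836-b`)

Composition (sorry-free glue at the end): the crux BY NAME is
`stub_transfer stub_minNormalisation boundaryRigidity_of_stubs`, exactly as in line `logderiv-peeling`
(shared transfer layer, T1 already LANDED by the first lead and imported here); boundary rigidity is
`stub_cellwiseFold stub_coneDecomposition` (shared fold layer, verbatim) on top of the STRUCTURE
theorem `stub_structure` (this line's engine), whose registered hypotheses are the six engine stubs:

* `stub_taylorMorphism` — the `C^∞` Taylor morphism at `0` from real germs into `ℝ⸨X⸩`
  (`LaurentSeries ℝ`): local, additive, multiplicative, intertwines `deriv` with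
  `LaurentSeries.derivative`, constants `↦ C`, `id ↦ X`, kernel = flat germs, constant term = value.
* `stub_oneVarSemialgebraic` — one-variable real-semialgebraic toolkit: a function semialgebraic
  over `ℝ` on an interval satisfies a non-trivial polynomial identity `q(φ t, t) = 0`, and a `C^∞`
  such function that is FLAT at `0` vanishes near `0` (replaces analyticity / the Nash upgrade).
* `stub_rosenlichtProperty` — in the differential field `(ℝ⸨X⸩, d/dX)`: the elements algebraic over
  `ℝ(X)` are stable under `d/dX`, and Rosenlicht's Prop. 4 holds for them relative to the constants
  (`Σ cⱼ duⱼ/uⱼ + dv = 0`, `cⱼ` constants `ℚ`-independent, `uⱼ, v` algebraic over `ℝ(X)` ⇒ `duⱼ = 0`),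
  from the tree's `Rosenlicht.isAlgebraic_of_forall_derivation`.
* `stub_abstractLogLinear` — pure differential algebra (the linear shadow of Ax–Schanuel, dual form):
  over a `D`-stable subfield `F` containing the constants and having the Rosenlicht property,
  a relation `Σ ηᵢ yᵢ = g` with `ηᵢ, g ∈ F`, `D yᵢ = D wᵢ / wᵢ`, `wᵢ ∈ Fˣ` forces `Σ pᵢ ηᵢ = 0` for
  every integer `p` orthogonal to the lattice `{f ∈ ℤᵏ | D (Σ fᵢ yᵢ) = 0}`; plus the real
  double-orthogonal lemma for integer vectors.
* `stub_constBlockDescent` — the constant block (Baker in relation-span form at rational points,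
  density, continuity): `Σ q_r(x) log θ_r = g(x)` with `θ_r` positive algebraic NUMBERS forces
  `q(x) ∈ span_ℝ {m ∈ ℤᴿ | Π θ_r^{m_r} = 1}`.
* `stub_uniformCells` — finitely many disjoint open preconnected `ℚ`-semialgebraic cells, co-null,
  on which all data are `C^∞` and, for EVERY `f ∈ ℤᵏ`, either `W^f` is constant on the cell or the
  zero set of the log-gradient `Σ fᵢ ∇Wᵢ/Wᵢ` has empty interior in the cell (cells of constancy of
  the local kernel of the log-gradient matrix).

`stub_structure` (held by the lead) assembles them: on a cell, at an a.e. (good) point and along a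
generic direction, the Taylor morphism carries the one-variable restriction into `ℝ⸨X⸩`, the abstract
theorem applies with `F` = the relative algebraic closure of `ℝ(X)`, flatness identifies the abstract
lattice with the cell's lattice, whence `h(x) ∈ span_ℝ Λ(cell)`; then the constant block and the
rational reproducing matrix (`descent_lattice_reproduce`, landed) give the registered conclusion
(identical to line `logderiv-peeling`'s `stub_descent` conclusion, so the shared glue applies).

Shared stubs (verbatim copies of the ACTIVE registered stubs of line `logderiv-peeling`, kept so that
registration of this skeleton does not expire them; replaced by imports as they land):
`stub_transfer`, `stub_coneDecomposition`, `stub_cellwiseFold`, `stub_peelingStep`,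
`stub_constRigidity`, `stub_descent` (the last three are not used by this line's composition).
-/

noncomputable section

open Set MeasureTheory Filter
open scoped ContDiff Topology LaurentSeries RatFunc
open Literature.NumberTheory.Transcendental Literature.ModelTheory.ExponentialFields

namespace Summit.KontsevichZagierPeriods.LiouvilleUnfolding.LogPrimitiveNL.AxSchanuelGerms

open Summit.KontsevichZagierPeriods.KontsevichZagierPeriods.Theses.LiouvilleUnfolding (LogPrimitiveNL)

/-! ## Engine stubs (this line) -/

/-- **Taylor morphism at `0`** (`C^∞` real germs `→ ℝ⸨X⸩`): there is a map `T` from real functions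
to Laurent series which depends only on the germ at `0`, is additive and multiplicative on functions
`C^∞` near `0`, intertwines `deriv` with `LaurentSeries.derivative`, sends constants to `C c` and the
identity to `X`, takes values in power series, has constant coefficient the value at `0`, and kills
exactly the FLAT germs (all derivatives at `0` vanish). (`T f = Σ f⁽ⁿ⁾(0)/n! Xⁿ`.) -/
theorem stub_taylorMorphism :
    ∃ T : (ℝ → ℝ) → ℝ⸨X⸩,
      (∀ f g : ℝ → ℝ, f =ᶠ[𝓝 0] g → T f = T g) ∧
      (∀ f g : ℝ → ℝ, (∃ U ∈ 𝓝 (0 : ℝ), ContDiffOn ℝ ∞ f U) →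
        (∃ U ∈ 𝓝 (0 : ℝ), ContDiffOn ℝ ∞ g U) →
          T (f + g) = T f + T g ∧ T (f * g) = T f * T g) ∧
      (∀ f : ℝ → ℝ, (∃ U ∈ 𝓝 (0 : ℝ), ContDiffOn ℝ ∞ f U) →
        T (deriv f) = LaurentSeries.derivative ℝ (T f)) ∧
      (∀ c : ℝ, T (fun _ => c) = HahnSeries.C c) ∧
      T (fun t => t) = HahnSeries.single 1 1 ∧
      (∀ f : ℝ → ℝ, ∃ p : PowerSeries ℝ, T f = HahnSeries.ofPowerSeries ℤ ℝ p) ∧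
      (∀ f : ℝ → ℝ, (T f).coeff 0 = f 0) ∧
      (∀ f : ℝ → ℝ, (∃ U ∈ 𝓝 (0 : ℝ), ContDiffOn ℝ ∞ f U) →
        (T f = 0 ↔ ∀ n : ℕ, iteratedDeriv n f 0 = 0)) := by
  sorry

/-- **One-variable real-semialgebraic toolkit.** (1) A function whose graph over an open interval is
semialgebraic over `ℝ` satisfies a non-trivial polynomial identity `q(φ t, t) = 0` on the interval
(its graph has empty interior, sign-condition normal form; product of the finitely many polynomials).
(2) FLATNESS: such a function which is moreover `C^∞` on the interval and has all derivatives `0`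
at `0` vanishes identically near `0` (Taylor remainder against the lowest non-vanishing
`Y`-coefficient of `q`, which is a non-zero real polynomial in `t`). -/
theorem stub_oneVarSemialgebraic :
    (∀ (φ : ℝ → ℝ) (a b : ℝ), a < b →
      IsSemialgebraicFunOn ℝ {x : Fin 1 → ℝ | x 0 ∈ Ioo a b} (fun x => φ (x 0)) →
        ∃ q : MvPolynomial (Fin 2) ℝ, q ≠ 0 ∧
          ∀ t ∈ Ioo a b, MvPolynomial.eval (Fin.cons (φ t) fun _ => t) q = 0) ∧
    (∀ (φ : ℝ → ℝ) (ε : ℝ), 0 < ε →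
      IsSemialgebraicFunOn ℝ {x : Fin 1 → ℝ | x 0 ∈ Ioo (-ε) ε} (fun x => φ (x 0)) →
        ContDiffOn ℝ ∞ φ (Ioo (-ε) ε) → (∀ n : ℕ, iteratedDeriv n φ 0 = 0) →
          ∀ᶠ t in 𝓝 (0 : ℝ), φ t = 0) := by
  sorry

/-- **Rosenlicht property of the algebraic elements of `(ℝ⸨X⸩, d/dX)`.** (1) The elements of
`ℝ⸨X⸩` algebraic over `ℝ(X)` are stable under `d/dX` (differentiate the minimal equation).
(2) For real constants `cⱼ = C eⱼ` with `eⱼ` linearly independent over `ℚ`, non-zero `uⱼ` and `v`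
algebraic over `ℝ(X)`: `Σ cⱼ duⱼ/uⱼ + dv = 0 ⇒ duⱼ = 0` for all `j` (every `ℝ`-derivation of the relative
algebraic closure `F` of `ℝ(X)` is an `F`-multiple of `d/dX`, so Rosenlicht 1976 Prop. 4 in the
tree's dual form `Rosenlicht.isAlgebraic_of_forall_derivation` makes `uⱼ` algebraic over `ℝ`, hence
killed by `d/dX`). -/
theorem stub_rosenlichtProperty :
    (∀ x : ℝ⸨X⸩, IsAlgebraic (RatFunc ℝ) x →
      IsAlgebraic (RatFunc ℝ) (LaurentSeries.derivative ℝ x)) ∧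
    (∀ (m : ℕ) (e : Fin m → ℝ) (u : Fin m → ℝ⸨X⸩) (v : ℝ⸨X⸩), LinearIndependent ℚ e →
      (∀ j, IsAlgebraic (RatFunc ℝ) (u j)) → (∀ j, u j ≠ 0) → IsAlgebraic (RatFunc ℝ) v →
      (∑ j, HahnSeries.C (e j) * ((u j)⁻¹ * LaurentSeries.derivative ℝ (u j))) +
          LaurentSeries.derivative ℝ v = 0 →
        ∀ j, LaurentSeries.derivative ℝ (u j) = 0) := by
  sorry

/-- **Abstract log-linear rigidity** (linear shadow of Ax–Schanuel, dual form; pure differential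
algebra) and the real double-orthogonal lemma. (1) `L` a field of characteristic `0` with a
derivation `D`, `F` a `D`-stable subfield containing the constants and having the Rosenlicht
property; `ηᵢ, g ∈ F`, `wᵢ ∈ F` non-zero, `D yᵢ = D wᵢ / wᵢ`, `Σ ηᵢ yᵢ = g`. Then `Σ pᵢ ηᵢ = 0` for
every `p ∈ ℤᵏ` orthogonal to the lattice `Λ = {f ∈ ℤᵏ | D (Σ fᵢ yᵢ) = 0}` (Kolchin–Ostrowski
differentiation to constant coefficients, Rosenlicht to rational exponents, induction on `k`).
(2) For a set `S ⊆ ℤᵏ`, a real vector orthogonal to every integer vector orthogonal to `S` lies in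
the real span of `S`. -/
theorem stub_abstractLogLinear :
    (∀ (L : Type) [Field L] [CharZero L] (D : Derivation ℤ L L) (F : Subfield L),
      (∀ x ∈ F, D x ∈ F) → (∀ x, D x = 0 → x ∈ F) →
      (∀ (m : ℕ) (c u : Fin m → L) (v : L), (∀ j, D (c j) = 0) → LinearIndependent ℚ c →
        (∀ j, u j ∈ F) → (∀ j, u j ≠ 0) → v ∈ F →
        (∑ j, c j * ((u j)⁻¹ * D (u j))) + D v = 0 → ∀ j, D (u j) = 0) →
      ∀ (k : ℕ) (η w y : Fin k → L) (g : L), (∀ i, η i ∈ F) → (∀ i, w i ∈ F) →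
        (∀ i, w i ≠ 0) → (∀ i, D (y i) = (w i)⁻¹ * D (w i)) → g ∈ F →
        ∑ i, η i * y i = g →
        ∀ p : Fin k → ℤ,
          (∀ f : Fin k → ℤ, D (∑ i, (f i : L) * y i) = 0 → ∑ i, p i * f i = 0) →
          ∑ i, (p i : L) * η i = 0) ∧
    (∀ (k : ℕ) (S : Set (Fin k → ℤ)) (v : Fin k → ℝ),
      (∀ p : Fin k → ℤ, (∀ f ∈ S, ∑ i, p i * f i = 0) → ∑ i, (p i : ℝ) * v i = 0) →
      v ∈ Submodule.span ℝ {φ : Fin k → ℝ | ∃ f ∈ S, φ = fun i => (f i : ℝ)}) := by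
  sorry

/-- **Constant block** (Baker, relation-span form, spread over an open cell): on an open
`ℚ`-semialgebraic `C`, if continuous `ℚ`-semialgebraic `q_r` and a `ℚ`-semialgebraic `g` satisfy
`Σ_r q_r(x) log θ_r = g(x)` with positive ALGEBRAIC numbers `θ_r`, then at every point `q(x)` lies in
the real span of the integer relation lattice `{m ∈ ℤᴿ | Π θ_r^{m_r} = 1}` (at rational points the
values are algebraic and `baker_relation_span_int` applies — real parts of the `ℚ̄`-coefficients;
rational points are dense in `C`, `q` is continuous and the span is closed). -/
theorem stub_constBlockDescent :
    ∀ (n R : ℕ) (C : Set (Fin n → ℝ)) (q : Fin R → (Fin n → ℝ) → ℝ) (g : (Fin n → ℝ) → ℝ)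
      (θ : Fin R → ℝ), IsSemialgebraic ℚ C → IsOpen C →
      (∀ r, IsSemialgebraicFunOn ℚ C (q r)) → (∀ r, ContinuousOn (q r) C) →
      IsSemialgebraicFunOn ℚ C g → (∀ r, IsAlgebraic ℚ (θ r)) → (∀ r, 0 < θ r) →
      (∀ x ∈ C, ∑ r, q r x * Real.log (θ r) = g x) →
      ∀ x ∈ C, (fun r => q r x) ∈ Submodule.span ℝ
        {φ : Fin R → ℝ | ∃ m : Fin R → ℤ, ∏ r, θ r ^ (m r) = 1 ∧ φ = fun r => (m r : ℝ)} := by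
  sorry

/-- **Uniform cells** (replaces the card's Nash cells; no analyticity needed): for positive
`ℚ`-semialgebraic `Wᵢ` and finitely many further `ℚ`-semialgebraic functions `Fₘ` on a
`ℚ`-semialgebraic `U ⊆ ℝⁿ` there are finitely many pairwise disjoint open preconnected
`ℚ`-semialgebraic cells `C_c ⊆ U` with `U \ ⋃ C_c` null, on which all `Wᵢ, Fₘ` are `C^∞`, such that
for every cell and EVERY integer vector `f`: either the monomial `Π Wᵢ^{fᵢ}` is constant on the cell,
or the zero set (in the cell) of its log-gradient `Σᵢ fᵢ ∂ⱼWᵢ/Wᵢ` (all `j`) has empty interior.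
(Cells = connected components of the open strata on which the dimension of the LOCAL kernel of the
log-gradient matrix is constant; the strata are semialgebraic by Tarski–Seidenberg.) -/
theorem stub_uniformCells :
    ∀ (n k M : ℕ) (U : Set (Fin n → ℝ)) (W : Fin k → (Fin n → ℝ) → ℝ)
      (F : Fin M → (Fin n → ℝ) → ℝ), IsSemialgebraic ℚ U →
      (∀ i, IsSemialgebraicFunOn ℚ U (W i)) → (∀ i, ∀ x ∈ U, 0 < W i x) →
      (∀ m, IsSemialgebraicFunOn ℚ U (F m)) →
      ∃ (N : ℕ) (C : Fin N → Set (Fin n → ℝ)),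
        (∀ c, IsSemialgebraic ℚ (C c) ∧ IsOpen (C c) ∧ IsPreconnected (C c) ∧ C c ⊆ U) ∧
        Pairwise (Function.onFun Disjoint C) ∧ volume (U \ ⋃ c, C c) = 0 ∧
        (∀ c i, ContDiffOn ℝ ∞ (W i) (C c)) ∧ (∀ c m, ContDiffOn ℝ ∞ (F m) (C c)) ∧
        ∀ c (f : Fin k → ℤ),
          (∃ θ : ℝ, ∀ x ∈ C c, ∏ i, W i x ^ (f i) = θ) ∨
          interior {x ∈ C c | ∀ j : Fin n,
            ∑ i, (f i : ℝ) * (fderiv ℝ (W i) x (Pi.single j 1) / W i x) = 0} = ∅ := by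
  sorry

/-- **STRUCTURE THEOREM** (this line's hardest stub, held by the lead): from the six engine stubs,
the structure of `ℚ`-semialgebraic log-linear identities `Σ hᵢ log Wᵢ = g` on a `ℚ`-semialgebraic
`U`: finitely many disjoint open semialgebraic cells, co-null, on each of which `g ≡ 0` and
`h = Σ_r q_r f_r` with `q_r` `ℚ`-semialgebraic and exact multiplicative relations `Π Wᵢ^{f_r i} ≡ 1`
(conclusion verbatim that of line `logderiv-peeling`'s `stub_descent`, so the fold glue is shared).
Proof route: uniform cells; on a cell, at a good point (a.e.: off countably many null semialgebraic
zero sets) and along a direction avoiding countably many hyperplanes, restrict to the line, apply the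
Taylor morphism into `ℝ⸨X⸩`, the abstract theorem with `F` = algebraic elements over `ℝ(X)`
(polynomial identities of the one-variable toolkit give membership, the Rosenlicht property its
hypothesis), identify the abstract lattice with the cell lattice by flatness, conclude
`h(x₀) ∈ span_ℝ Λ(cell)` by double orthogonality, spread by density + continuity; constant block on
the cell lattice's constants; rational reproducing matrix (`descent_lattice_reproduce`). -/
theorem stub_structure :
    (∃ T : (ℝ → ℝ) → ℝ⸨X⸩,
      (∀ f g : ℝ → ℝ, f =ᶠ[𝓝 0] g → T f = T g) ∧
      (∀ f g : ℝ → ℝ, (∃ U ∈ 𝓝 (0 : ℝ), ContDiffOn ℝ ∞ f U) →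
        (∃ U ∈ 𝓝 (0 : ℝ), ContDiffOn ℝ ∞ g U) →
          T (f + g) = T f + T g ∧ T (f * g) = T f * T g) ∧
      (∀ f : ℝ → ℝ, (∃ U ∈ 𝓝 (0 : ℝ), ContDiffOn ℝ ∞ f U) →
        T (deriv f) = LaurentSeries.derivative ℝ (T f)) ∧
      (∀ c : ℝ, T (fun _ => c) = HahnSeries.C c) ∧
      T (fun t => t) = HahnSeries.single 1 1 ∧
      (∀ f : ℝ → ℝ, ∃ p : PowerSeries ℝ, T f = HahnSeries.ofPowerSeries ℤ ℝ p) ∧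
      (∀ f : ℝ → ℝ, (T f).coeff 0 = f 0) ∧
      (∀ f : ℝ → ℝ, (∃ U ∈ 𝓝 (0 : ℝ), ContDiffOn ℝ ∞ f U) →
        (T f = 0 ↔ ∀ n : ℕ, iteratedDeriv n f 0 = 0))) →
    ((∀ (φ : ℝ → ℝ) (a b : ℝ), a < b →
      IsSemialgebraicFunOn ℝ {x : Fin 1 → ℝ | x 0 ∈ Ioo a b} (fun x => φ (x 0)) →
        ∃ q : MvPolynomial (Fin 2) ℝ, q ≠ 0 ∧
          ∀ t ∈ Ioo a b, MvPolynomial.eval (Fin.cons (φ t) fun _ => t) q = 0) ∧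
    (∀ (φ : ℝ → ℝ) (ε : ℝ), 0 < ε →
      IsSemialgebraicFunOn ℝ {x : Fin 1 → ℝ | x 0 ∈ Ioo (-ε) ε} (fun x => φ (x 0)) →
        ContDiffOn ℝ ∞ φ (Ioo (-ε) ε) → (∀ n : ℕ, iteratedDeriv n φ 0 = 0) →
          ∀ᶠ t in 𝓝 (0 : ℝ), φ t = 0)) →
    ((∀ x : ℝ⸨X⸩, IsAlgebraic (RatFunc ℝ) x →
      IsAlgebraic (RatFunc ℝ) (LaurentSeries.derivative ℝ x)) ∧
    (∀ (m : ℕ) (e : Fin m → ℝ) (u : Fin m → ℝ⸨X⸩) (v : ℝ⸨X⸩), LinearIndependent ℚ e →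
      (∀ j, IsAlgebraic (RatFunc ℝ) (u j)) → (∀ j, u j ≠ 0) → IsAlgebraic (RatFunc ℝ) v →
      (∑ j, HahnSeries.C (e j) * ((u j)⁻¹ * LaurentSeries.derivative ℝ (u j))) +
          LaurentSeries.derivative ℝ v = 0 →
        ∀ j, LaurentSeries.derivative ℝ (u j) = 0)) →
    ((∀ (L : Type) [Field L] [CharZero L] (D : Derivation ℤ L L) (F : Subfield L),
      (∀ x ∈ F, D x ∈ F) → (∀ x, D x = 0 → x ∈ F) →
      (∀ (m : ℕ) (c u : Fin m → L) (v : L), (∀ j, D (c j) = 0) → LinearIndependent ℚ c →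
        (∀ j, u j ∈ F) → (∀ j, u j ≠ 0) → v ∈ F →
        (∑ j, c j * ((u j)⁻¹ * D (u j))) + D v = 0 → ∀ j, D (u j) = 0) →
      ∀ (k : ℕ) (η w y : Fin k → L) (g : L), (∀ i, η i ∈ F) → (∀ i, w i ∈ F) →
        (∀ i, w i ≠ 0) → (∀ i, D (y i) = (w i)⁻¹ * D (w i)) → g ∈ F →
        ∑ i, η i * y i = g →
        ∀ p : Fin k → ℤ,
          (∀ f : Fin k → ℤ, D (∑ i, (f i : L) * y i) = 0 → ∑ i, p i * f i = 0) →
          ∑ i, (p i : L) * η i = 0) ∧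
    (∀ (k : ℕ) (S : Set (Fin k → ℤ)) (v : Fin k → ℝ),
      (∀ p : Fin k → ℤ, (∀ f ∈ S, ∑ i, p i * f i = 0) → ∑ i, (p i : ℝ) * v i = 0) →
      v ∈ Submodule.span ℝ {φ : Fin k → ℝ | ∃ f ∈ S, φ = fun i => (f i : ℝ)})) →
    (∀ (n R : ℕ) (C : Set (Fin n → ℝ)) (q : Fin R → (Fin n → ℝ) → ℝ) (g : (Fin n → ℝ) → ℝ)
      (θ : Fin R → ℝ), IsSemialgebraic ℚ C → IsOpen C →
      (∀ r, IsSemialgebraicFunOn ℚ C (q r)) → (∀ r, ContinuousOn (q r) C) →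
      IsSemialgebraicFunOn ℚ C g → (∀ r, IsAlgebraic ℚ (θ r)) → (∀ r, 0 < θ r) →
      (∀ x ∈ C, ∑ r, q r x * Real.log (θ r) = g x) →
      ∀ x ∈ C, (fun r => q r x) ∈ Submodule.span ℝ
        {φ : Fin R → ℝ | ∃ m : Fin R → ℤ, ∏ r, θ r ^ (m r) = 1 ∧ φ = fun r => (m r : ℝ)}) →
    (∀ (n k M : ℕ) (U : Set (Fin n → ℝ)) (W : Fin k → (Fin n → ℝ) → ℝ)
      (F : Fin M → (Fin n → ℝ) → ℝ), IsSemialgebraic ℚ U →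
      (∀ i, IsSemialgebraicFunOn ℚ U (W i)) → (∀ i, ∀ x ∈ U, 0 < W i x) →
      (∀ m, IsSemialgebraicFunOn ℚ U (F m)) →
      ∃ (N : ℕ) (C : Fin N → Set (Fin n → ℝ)),
        (∀ c, IsSemialgebraic ℚ (C c) ∧ IsOpen (C c) ∧ IsPreconnected (C c) ∧ C c ⊆ U) ∧
        Pairwise (Function.onFun Disjoint C) ∧ volume (U \ ⋃ c, C c) = 0 ∧
        (∀ c i, ContDiffOn ℝ ∞ (W i) (C c)) ∧ (∀ c m, ContDiffOn ℝ ∞ (F m) (C c)) ∧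
        ∀ c (f : Fin k → ℤ),
          (∃ θ : ℝ, ∀ x ∈ C c, ∏ i, W i x ^ (f i) = θ) ∨
          interior {x ∈ C c | ∀ j : Fin n,
            ∑ i, (f i : ℝ) * (fderiv ℝ (W i) x (Pi.single j 1) / W i x) = 0} = ∅) →
    ∀ (n k : ℕ) (U : Set (Fin n → ℝ)) (h W : Fin k → (Fin n → ℝ) → ℝ) (g : (Fin n → ℝ) → ℝ),
      IsSemialgebraic ℚ U → (∀ i, IsSemialgebraicFunOn ℚ U (h i)) →
      (∀ i, IsSemialgebraicFunOn ℚ U (W i)) → (∀ i, ∀ x ∈ U, 0 < W i x) →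
      IsSemialgebraicFunOn ℚ U g → (∀ x ∈ U, ∑ i, h i x * Real.log (W i x) = g x) →
      ∃ (N : ℕ) (C : Fin N → Set (Fin n → ℝ)),
        (∀ c, IsSemialgebraic ℚ (C c) ∧ IsOpen (C c) ∧ C c ⊆ U) ∧
        Pairwise (Function.onFun Disjoint C) ∧ volume (U \ ⋃ c, C c) = 0 ∧
        ∀ c, (∀ x ∈ C c, g x = 0) ∧
          ∃ (R : ℕ) (f : Fin R → Fin k → ℤ) (q : Fin R → (Fin n → ℝ) → ℝ),
            (∀ r, IsSemialgebraicFunOn ℚ (C c) (q r)) ∧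
            (∀ r, ∀ x ∈ C c, ∏ i, W i x ^ (f r i) = 1) ∧
            (∀ i, ∀ x ∈ C c, h i x = ∑ r, q r x * (f r i : ℝ)) := by
  sorry

/-! ## Shared stubs (verbatim copies of line `logderiv-peeling`'s ACTIVE registered stubs) -/

/-- **T2, transfer** (shared with line `logderiv-peeling`, verbatim): min-normalisation and boundary
rigidity imply the crux. -/
theorem stub_transfer :
    (∀ (n : ℕ) (τ : Set (Fin n → ℝ)) (a b : (Fin n → ℝ) → ℝ) (h : (Fin n → ℝ) → ℝ)
      (V V' : (Fin (n + 1) → ℝ) → ℝ),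
      IsSemialgebraic ℚ τ → IsSemialgebraicFunOn ℚ τ a → IsSemialgebraicFunOn ℚ τ b →
      (∀ x ∈ τ, a x ≤ b x) → IsSemialgebraicFunOn ℚ τ h →
      IsSemialgebraicFunOn ℚ {z | (Fin.init z : Fin n → ℝ) ∈ τ ∧ a (Fin.init z) ≤ z (Fin.last n) ∧
        z (Fin.last n) ≤ b (Fin.init z)} V →
      (∀ z ∈ {z | (Fin.init z : Fin n → ℝ) ∈ τ ∧ a (Fin.init z) ≤ z (Fin.last n) ∧
        z (Fin.last n) ≤ b (Fin.init z)}, 0 < V z) →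
      (∀ x ∈ τ, ContinuousOn (fun t : ℝ => V (Fin.snoc x t)) (Set.Icc (a x) (b x))) →
      (∀ x ∈ τ, ∀ t ∈ Set.Ioo (a x) (b x),
        HasDerivAt (fun s : ℝ => V (Fin.snoc x s)) (V' (Fin.snoc x t)) t) →
      IntegrableOn (fun z => h (Fin.init z) * V' z / V z)
        {z | (Fin.init z : Fin n → ℝ) ∈ τ ∧ a (Fin.init z) ≤ z (Fin.last n) ∧
          z (Fin.last n) ≤ b (Fin.init z)} →
      ∃ m : (Fin n → ℝ) → ℝ, IsSemialgebraicFunOn ℚ τ m ∧ (∀ x ∈ τ, 0 < m x) ∧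
        (∀ x ∈ τ, ∀ t ∈ Set.Icc (a x) (b x), m x ≤ V (Fin.snoc x t)) ∧
        IntegrableOn (fun x => h x * Real.log (V (Fin.snoc x (b x)) / m x)) τ ∧
        IntegrableOn (fun x => h x * Real.log (V (Fin.snoc x (a x)) / m x)) τ) →
    Negative.BoundaryRigidity →
    ∀ (n k : ℕ) (r : KZ.IntegralRep (n + 1)) (r' : KZ.IntegralRep n) (a b : (Fin n → ℝ) → ℝ)
      (h : Fin k → (Fin n → ℝ) → ℝ) (V V' : Fin k → (Fin (n + 1) → ℝ) → ℝ),
      IsSemialgebraicFunOn ℚ r'.domain a → IsSemialgebraicFunOn ℚ r'.domain b →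
      (∀ x ∈ r'.domain, a x ≤ b x) →
      r.domain = {z | (Fin.init z : Fin n → ℝ) ∈ r'.domain ∧ a (Fin.init z) ≤ z (Fin.last n) ∧
        z (Fin.last n) ≤ b (Fin.init z)} →
      (∀ i, IsSemialgebraicFunOn ℚ r'.domain (h i)) →
      (∀ i, IsSemialgebraicFunOn ℚ r.domain (V i)) →
      (∀ i, ∀ z ∈ r.domain, 0 < V i z) →
      (∀ i, ∀ x ∈ r'.domain, ContinuousOn (fun t : ℝ => V i (Fin.snoc x t)) (Set.Icc (a x) (b x))) →
      (∀ i, ∀ x ∈ r'.domain, ∀ t ∈ Set.Ioo (a x) (b x),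
        HasDerivAt (fun s : ℝ => V i (Fin.snoc x s)) (V' i (Fin.snoc x t)) t) →
      (∀ i, IntegrableOn (fun z => h i (Fin.init z) * V' i z / V i z) r.domain) →
      (∀ x ∈ r'.domain, ∀ t ∈ Set.Ioo (a x) (b x),
        r.integrand (Fin.snoc x t) = ∑ i, h i x * V' i (Fin.snoc x t) / V i (Fin.snoc x t)) →
      (∀ x ∈ r'.domain, r'.integrand x =
        ∑ i, h i x * (Real.log (V i (Fin.snoc x (b x))) - Real.log (V i (Fin.snoc x (a x))))) →
      KZ.of r - KZ.of r' ∈ KZ.relations := by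
  sorry

/-- **Cone decomposition** (finite-dimensional, no analysis): for integer vectors `f₁, …, f_R ∈ ℤᵏ`
there are finitely many "simplicial charts" `a`, each with a positive integer `N a`, integer rows
`b a l ∈ ℤᵏ` (`l < p`) and natural exponents `A a i l`, every column `(A a · l)` orthogonal to all
`f_r`, such that every nonnegative real vector `ℓ` orthogonal to all `f_r` lies in some chart:
`b a l · ℓ ≥ 0` for all `l` and `N a · ℓ_i = Σ_l A a i l · (b a l · ℓ)` for all `i`. (Charts =
linearly independent sets of minimal-support nonnegative integer vectors of `ker F`; `b` = `N ×` a
rational left inverse; covering by the conformal/Carathéodory decomposition of `ker F ∩ ℝᵏ_{≥0}`.) -/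
theorem stub_coneDecomposition :
    ∀ (k R : ℕ) (f : Fin R → Fin k → ℤ),
      ∃ (m p : ℕ) (N : Fin m → ℕ) (b : Fin m → Fin p → Fin k → ℤ) (A : Fin m → Fin k → Fin p → ℕ),
        (∀ a, 0 < N a) ∧
        (∀ a l r, ∑ i, f r i * (A a i l : ℤ) = 0) ∧
        ∀ ℓ : Fin k → ℝ, (∀ i, 0 ≤ ℓ i) → (∀ r, ∑ i, (f r i : ℝ) * ℓ i = 0) →
          ∃ a, (∀ l, 0 ≤ ∑ i, (b a l i : ℝ) * ℓ i) ∧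
            ∀ i, (N a : ℝ) * ℓ i = ∑ l, (A a i l : ℝ) * ∑ i', (b a l i' : ℝ) * ℓ i' := by
  sorry

/-- **Cellwise fold** (registered `stub_cellwiseFold`, now fed by `ConeDecomposition`): over a
`ℚ`-semialgebraic `σ` with `W ≥ 1`, given finitely many disjoint open semialgebraic cells covering `σ`
up to a null set, on each of which `h = Σ_r q_r f_r` with `∏ W^{f_r} ≡ 1` and `q_r` semialgebraic, the
unfolded monomials `Uᵢ = [{x ∈ σ, 1 ≤ u ≤ Wᵢ x}, hᵢ x/u]` sum to a relation. On a cell, on the chart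
piece `{x | W^{b a l} ≥ 1 ∀ l, Wᵢ^{N} = ∏_l (W^{b a l})^{A i l} ∀ i}` (semialgebraic, covering by
`ConeDecomposition` applied to `ℓ = log W(x)`): power rule `N[Uᵢ] ∼ [{1 ≤ u ≤ Wᵢ^N}, hᵢ/u]`, product
rule `KZ.of_sub_of_sub_mem_relations_mul` peels the factors `M_l = W^{b a l} ≥ 1` (intermediate
monomials dominated by `N |hᵢ| log Wᵢ`, hence admissible), regrouping by `l` gives integrands
`(Σᵢ A i l hᵢ)/u = 0`; integer division `mem_relations_of_nsmul_mem_relations`; pieces and the null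
remainder by domain additivity. -/
theorem stub_cellwiseFold :
    (∀ (k R : ℕ) (f : Fin R → Fin k → ℤ),
      ∃ (m p : ℕ) (N : Fin m → ℕ) (b : Fin m → Fin p → Fin k → ℤ) (A : Fin m → Fin k → Fin p → ℕ),
        (∀ a, 0 < N a) ∧
        (∀ a l r, ∑ i, f r i * (A a i l : ℤ) = 0) ∧
        ∀ ℓ : Fin k → ℝ, (∀ i, 0 ≤ ℓ i) → (∀ r, ∑ i, (f r i : ℝ) * ℓ i = 0) →
          ∃ a, (∀ l, 0 ≤ ∑ i, (b a l i : ℝ) * ℓ i) ∧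
            ∀ i, (N a : ℝ) * ℓ i = ∑ l, (A a i l : ℝ) * ∑ i', (b a l i' : ℝ) * ℓ i') →
    ∀ (n k : ℕ) (σ : Set (Fin n → ℝ)) (h W : Fin k → (Fin n → ℝ) → ℝ)
      (U : Fin k → KZ.IntegralRep (n + 1)) (N : ℕ) (C : Fin N → Set (Fin n → ℝ)),
      IsSemialgebraic ℚ σ → (∀ i, IsSemialgebraicFunOn ℚ σ (h i)) →
      (∀ i, IsSemialgebraicFunOn ℚ σ (W i)) → (∀ i, ∀ x ∈ σ, 1 ≤ W i x) →
      (∀ i, (U i).domain = {z | (Fin.init z : Fin n → ℝ) ∈ σ ∧ 1 ≤ z (Fin.last n) ∧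
        z (Fin.last n) ≤ W i (Fin.init z)}) →
      (∀ i, EqOn (U i).integrand (fun z => h i (Fin.init z) / z (Fin.last n)) (U i).domain) →
      (∀ i, IntegrableOn (fun x => h i x * Real.log (W i x)) σ) →
      (∀ c, IsSemialgebraic ℚ (C c) ∧ IsOpen (C c) ∧ C c ⊆ σ) →
      Pairwise (Function.onFun Disjoint C) → volume (σ \ ⋃ c, C c) = 0 →
      (∀ c, ∃ (R : ℕ) (f : Fin R → Fin k → ℤ) (q : Fin R → (Fin n → ℝ) → ℝ),
        (∀ r, IsSemialgebraicFunOn ℚ (C c) (q r)) ∧ (∀ r, ∀ x ∈ C c, ∏ i, W i x ^ (f r i) = 1) ∧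
        (∀ i, ∀ x ∈ C c, h i x = ∑ r, q r x * (f r i : ℝ))) →
      ∑ i, KZ.of (U i) ∈ KZ.relations := by
  sorry

/-- **Peeling step** (registered verbatim): one base-derivative of a normalised log-linear relation
`Σ φᵢ log Wᵢ + log P = γ` on an open semialgebraic `U` with differentiable semialgebraic data: the
partials `∂ⱼφᵢ` and the new right-hand side are `ℚ`-semialgebraic on `U` (BPR Prop. 3.22: the graph of
a partial derivative is first-order definable, `isSemialgebraic_setOf_realize_boundedFormula` /
`hasDerivAt_last_isSemialgebraic_holds` after a coordinate permutation), and the differentiated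
identity holds (product rule, `Real.hasDerivAt_log`). -/
theorem stub_peelingStep :
    ∀ (n k : ℕ) (U : Set (Fin n → ℝ)) (φ W : Fin k → (Fin n → ℝ) → ℝ) (P γ : (Fin n → ℝ) → ℝ)
      (j : Fin n), IsSemialgebraic ℚ U → IsOpen U → (∀ i, IsSemialgebraicFunOn ℚ U (φ i)) →
      (∀ i, DifferentiableOn ℝ (φ i) U) → (∀ i, IsSemialgebraicFunOn ℚ U (W i)) →
      (∀ i, DifferentiableOn ℝ (W i) U) → (∀ i, ∀ x ∈ U, 0 < W i x) → IsSemialgebraicFunOn ℚ U P →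
      DifferentiableOn ℝ P U → (∀ x ∈ U, 0 < P x) → IsSemialgebraicFunOn ℚ U γ →
      DifferentiableOn ℝ γ U → (∀ x ∈ U, ∑ i, φ i x * Real.log (W i x) + Real.log (P x) = γ x) →
      (∀ i, IsSemialgebraicFunOn ℚ U (fun x => fderiv ℝ (φ i) x (Pi.single j (1 : ℝ)))) ∧
      IsSemialgebraicFunOn ℚ U (fun x => fderiv ℝ γ x (Pi.single j (1 : ℝ)) -
        ∑ i, φ i x * fderiv ℝ (W i) x (Pi.single j (1 : ℝ)) / W i x -
        fderiv ℝ P x (Pi.single j (1 : ℝ)) / P x) ∧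
      (∀ x ∈ U, ∑ i, fderiv ℝ (φ i) x (Pi.single j (1 : ℝ)) * Real.log (W i x) =
        fderiv ℝ γ x (Pi.single j (1 : ℝ)) -
        ∑ i, φ i x * fderiv ℝ (W i) x (Pi.single j (1 : ℝ)) / W i x -
        fderiv ℝ P x (Pi.single j (1 : ℝ)) / P x) := by
  sorry

/-- **Constant-coefficient rigidity** (registered verbatim): an identity `Σ cᵢ log Wᵢ = G` on an
open `ℚ`-semialgebraic `D` with ALGEBRAIC constants `cᵢ`, continuous positive `ℚ`-semialgebraic `Wᵢ`
and continuous `ℚ`-semialgebraic `G` forces `G ≡ 0` and `c ∈ span_{ℚ̄} {f ∈ ℤᵏ | ∏ Wᵢ^{fᵢ} ≡ 1 on D}`: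
Baker (`baker_holds`) at the RATIONAL points of `D` (values of `ℚ`-semialgebraic functions there are
algebraic), the `ℚ`-free decomposition `c = Σ β_r f_r` making every `∏ Wᵢ^{f_r i}` equal to `1` at
every rational point, density of `ℚⁿ` and continuity. -/
theorem stub_constRigidity :
    ∀ (n k : ℕ) (D : Set (Fin n → ℝ)) (c : Fin k → ℝ) (W : Fin k → (Fin n → ℝ) → ℝ)
      (G : (Fin n → ℝ) → ℝ), IsSemialgebraic ℚ D → IsOpen D → (∀ i, IsAlgebraic ℚ (c i)) →
      (∀ i, IsSemialgebraicFunOn ℚ D (W i)) → (∀ i, ContinuousOn (W i) D) →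
      (∀ i, ∀ x ∈ D, 0 < W i x) → IsSemialgebraicFunOn ℚ D G → ContinuousOn G D →
      (∀ x ∈ D, ∑ i, c i * Real.log (W i x) = G x) →
      (∀ x ∈ D, G x = 0) ∧ ∃ (R : ℕ) (f : Fin R → Fin k → ℤ) (β : Fin R → ℝ),
        (∀ r, IsAlgebraic ℚ (β r)) ∧ (∀ r, ∀ x ∈ D, ∏ i, W i x ^ (f r i) = 1) ∧
        (∀ i, c i = ∑ r, β r * (f r i : ℝ)) := by
  sorry

/-- **Log-linear descent** (registered verbatim, the line's hardest stub, held by the lead): from the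
peeling step and constant-coefficient rigidity, the structure theorem for `ℚ`-semialgebraic
log-linear identities `Σ hᵢ log Wᵢ = g` on a `ℚ`-semialgebraic `U`: finitely many disjoint open
semialgebraic cells covering `U` up to a null set, on each of which `g ≡ 0` and `h = Σ_r q_r f_r`
with `q_r` `ℚ`-semialgebraic and exact multiplicative relations `∏ Wᵢ^{f_r i} ≡ 1` (Kolchin–Ostrowski
induction on `k` along the base: smooth locus, split `{h_k = 0}` / `{h_k ≠ 0}`, divide by the pivot,
differentiate in each `xⱼ` (peeling), induct, integrate the zero gradient back on connected
components modulo the current lattice, const-rigidity for the constant vector, reassemble). -/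
theorem stub_descent :
    (∀ (n k : ℕ) (U : Set (Fin n → ℝ)) (φ W : Fin k → (Fin n → ℝ) → ℝ) (P γ : (Fin n → ℝ) → ℝ)
      (j : Fin n), IsSemialgebraic ℚ U → IsOpen U → (∀ i, IsSemialgebraicFunOn ℚ U (φ i)) →
      (∀ i, DifferentiableOn ℝ (φ i) U) → (∀ i, IsSemialgebraicFunOn ℚ U (W i)) →
      (∀ i, DifferentiableOn ℝ (W i) U) → (∀ i, ∀ x ∈ U, 0 < W i x) → IsSemialgebraicFunOn ℚ U P →
      DifferentiableOn ℝ P U → (∀ x ∈ U, 0 < P x) → IsSemialgebraicFunOn ℚ U γ →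
      DifferentiableOn ℝ γ U → (∀ x ∈ U, ∑ i, φ i x * Real.log (W i x) + Real.log (P x) = γ x) →
      (∀ i, IsSemialgebraicFunOn ℚ U (fun x => fderiv ℝ (φ i) x (Pi.single j (1 : ℝ)))) ∧
      IsSemialgebraicFunOn ℚ U (fun x => fderiv ℝ γ x (Pi.single j (1 : ℝ)) -
        ∑ i, φ i x * fderiv ℝ (W i) x (Pi.single j (1 : ℝ)) / W i x -
        fderiv ℝ P x (Pi.single j (1 : ℝ)) / P x) ∧
      (∀ x ∈ U, ∑ i, fderiv ℝ (φ i) x (Pi.single j (1 : ℝ)) * Real.log (W i x) =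
        fderiv ℝ γ x (Pi.single j (1 : ℝ)) -
        ∑ i, φ i x * fderiv ℝ (W i) x (Pi.single j (1 : ℝ)) / W i x -
        fderiv ℝ P x (Pi.single j (1 : ℝ)) / P x)) →
    (∀ (n k : ℕ) (D : Set (Fin n → ℝ)) (c : Fin k → ℝ) (W : Fin k → (Fin n → ℝ) → ℝ)
      (G : (Fin n → ℝ) → ℝ), IsSemialgebraic ℚ D → IsOpen D → (∀ i, IsAlgebraic ℚ (c i)) →
      (∀ i, IsSemialgebraicFunOn ℚ D (W i)) → (∀ i, ContinuousOn (W i) D) →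
      (∀ i, ∀ x ∈ D, 0 < W i x) → IsSemialgebraicFunOn ℚ D G → ContinuousOn G D →
      (∀ x ∈ D, ∑ i, c i * Real.log (W i x) = G x) →
      (∀ x ∈ D, G x = 0) ∧ ∃ (R : ℕ) (f : Fin R → Fin k → ℤ) (β : Fin R → ℝ),
        (∀ r, IsAlgebraic ℚ (β r)) ∧ (∀ r, ∀ x ∈ D, ∏ i, W i x ^ (f r i) = 1) ∧
        (∀ i, c i = ∑ r, β r * (f r i : ℝ))) →
    ∀ (n k : ℕ) (U : Set (Fin n → ℝ)) (h W : Fin k → (Fin n → ℝ) → ℝ) (g : (Fin n → ℝ) → ℝ),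
      IsSemialgebraic ℚ U → (∀ i, IsSemialgebraicFunOn ℚ U (h i)) →
      (∀ i, IsSemialgebraicFunOn ℚ U (W i)) → (∀ i, ∀ x ∈ U, 0 < W i x) →
      IsSemialgebraicFunOn ℚ U g → (∀ x ∈ U, ∑ i, h i x * Real.log (W i x) = g x) →
      ∃ (N : ℕ) (C : Fin N → Set (Fin n → ℝ)),
        (∀ c, IsSemialgebraic ℚ (C c) ∧ IsOpen (C c) ∧ C c ⊆ U) ∧
        Pairwise (Function.onFun Disjoint C) ∧ volume (U \ ⋃ c, C c) = 0 ∧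
        ∀ c, (∀ x ∈ C c, g x = 0) ∧
          ∃ (R : ℕ) (f : Fin R → Fin k → ℤ) (q : Fin R → (Fin n → ℝ) → ℝ),
            (∀ r, IsSemialgebraicFunOn ℚ (C c) (q r)) ∧
            (∀ r, ∀ x ∈ C c, ∏ i, W i x ^ (f r i) = 1) ∧
            (∀ i, ∀ x ∈ C c, h i x = ∑ r, q r x * (f r i : ℝ)) := by
  sorry

/-! ## Glue (sorry-free) -/

/-- **Structure + fold ⇒ boundary rigidity.** The structure theorem (applied to
`g.integrand = Σ hᵢ log Wᵢ` on `g.domain`) gives cells on which `g.integrand = 0` — so `[g]` is a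
relation (`of_mem_relations_of_eqOn_zero_off_null`, landed glue of line `logderiv-peeling`) — and the
lattice structure that the shared cellwise fold turns into `Σ [Uᵢ] ∈ relations`. -/
theorem boundaryRigidity_of_stubs : Negative.BoundaryRigidity := by
  intro n k g h W U hh hW hW1 hUd hUi hUint hg
  have hσ : IsSemialgebraic ℚ g.domain := g.isSemialgebraic_domain
  have hWpos : ∀ i, ∀ x ∈ g.domain, 0 < W i x := fun i x hx => one_pos.trans_le (hW1 i x hx)
  obtain ⟨N, C, hC, hdisj, hnull, hcell⟩ :=
    stub_structure stub_taylorMorphism stub_oneVarSemialgebraic stub_rosenlichtProperty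
      stub_abstractLogLinear stub_constBlockDescent stub_uniformCells n k g.domain h W g.integrand
      hσ hh hW hWpos g.isSemialgebraicFunOn_integrand (fun x hx => (hg x hx).symm)
  have hfold : ∑ i, KZ.of (U i) ∈ KZ.relations :=
    stub_cellwiseFold stub_coneDecomposition n k g.domain h W U N C hσ hh hW hW1 hUd hUi hUint hC
      hdisj hnull (fun c => (hcell c).2)
  have hA : IsSemialgebraic ℚ (⋃ c, C c) := by
    have : (⋃ c, C c) = ⋃ c ∈ (Finset.univ : Finset (Fin N)), C c := by simp
    rw [this]
    exact IsSemialgebraic.biUnion _ _ fun c _ => (hC c).1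
  have hg0 : KZ.of g ∈ KZ.relations := by
    refine of_mem_relations_of_eqOn_zero_off_null n g (⋃ c, C c) hA
      (iUnion_subset fun c => (hC c).2.2) hnull fun x hx => ?_
    obtain ⟨c, hxc⟩ := mem_iUnion.1 hx
    exact (hcell c).1 x hxc
  exact KZ.relations.sub_mem hfold hg0

/-- **The composition**: the crux `LogPrimitiveNL`, BY NAME, from the stubs (shared transfer with the
LANDED min-normalisation `stub_minNormalisation` of line `logderiv-peeling`). -/
theorem LogPrimitiveNL_of : LogPrimitiveNL :=
  fun n k r r' a b h V V' =>
    stub_transfer LogPrimitiveNL.stub_minNormalisation boundaryRigidity_of_stubs n k r r' a b h V V'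

end Summit.KontsevichZagierPeriods.LiouvilleUnfolding.LogPrimitiveNL.AxSchanuelGerms

end

#h21_check_skeleton "stmt-KontsevichZagierPeriods-2836" Summit.KontsevichZagierPeriods.KontsevichZagierPeriods.Theses.LiouvilleUnfolding.LogPrimitiveNL stub_taylorMorphism stub_oneVarSemialgebraic stub_rosenlichtProperty stub_abstractLogLinear stub_constBlockDescent stub_uniformCells stub_structure stub_transfer stub_coneDecomposition stub_cellwiseFold stub_peelingStep stub_constRigidity stub_descent
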